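import Mathlib
import Summits.Ventures.HodgeRepro.Tier4.Line1.RTFSetting
import Summits.Ventures.HodgeRepro.Tier4.Line1.KernelSupportFinite
import Summits.Ventures.HodgeRepro.Tier4.Line1.KernelUnfold
import Summits.Ventures.HodgeRepro.Tier4.Line1.KernelOperator
import Summits.Ventures.HodgeRepro.Tier4.Line1.KernelOpEqR
import Summits.Ventures.HodgeRepro.Tier4.Line1.KernelEigen
import Summits.Ventures.HodgeRepro.Tier4.Line1.KernelNondegenerate
import Summits.Ventures.HodgeRepro.Tier4.Line1.InnerCalculus
import Summits.Ventures.HodgeRepro.Tier4.Line1.InnerBridge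
import Summits.Ventures.HodgeRepro.Tier4.Line1.KernelAdjointInner

/-!
# Tier4/Line1/OrthComplement — the continuous invariant functions orthogonal to a family of invariant subspaces

Blind re-derivation cell `pub-hodge-repro`, Tier 4 «prove the step» (README §9–§10), seat t4-L4-p1 (cross-line J1 glue,
lead S12599).  Tree path `lean/Summits/Ventures/HodgeRepro/Tier4/Line1/OrthComplement.lean`.  Mathlib-level.

WHAT IS PROVED.  For a family `F` of invariant subspaces, `orthSet F` = the continuous invariant functions orthogonal
(for `S.inner`) to every member of every `V ∈ F`: it is an `IsInvariantSubspace` (`orthSet_isInvariantSubspace`: right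
translation by p4's `inner_rightTranslate`, `R(f)` by p4's `inner_R_eq_inner_R_adj`), it is relatively closed in the
shape of (4b)'s `hclosed` (`orthSet_relClosed`: Cauchy–Schwarz through `InnerBridge`), and it is NON-ZERO as soon as
some `ψ₀ ∈ L²(DG)` not a.e. zero is orthogonal to every member (`exists_mem_orthSet_ne_zero`): rung (4a)
`kernelOp_nondegenerate` gives a test `f` with `K_f ψ₀ ≠ 0` a.e., and `K_f ψ₀` is continuous (`continuous_kernelOp`),
invariant (`kernelOp_invariant`) and orthogonal by the adjoint identity `inner_kernelOp_left` — no eigenvalue is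
needed for this step.  This is the step of J1's assembly that shows a maximal orthogonal family of irreducibles spans.

HC_CM is NOT proved by anyone in this repository.
-/

set_option autoImplicit false

noncomputable section

namespace Summit.Ventures.HodgeRepro.Tier4.Line1

open MeasureTheory Topology
open scoped ComplexConjugate InnerProductSpace

namespace RTF

variable {G : Type} [Group G] [TopologicalSpace G] [IsTopologicalGroup G] [MeasurableSpace G]
  [BorelSpace G]

namespace Setting

variable (S : Setting G)

/-- The continuous invariant functions orthogonal to every member of every `V ∈ F`. -/
def orthSet (F : Set (Set (G → ℂ))) : Set (G → ℂ) :=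
  {ψ | Continuous ψ ∧ S.Invariant ψ ∧ ∀ V ∈ F, ∀ w ∈ V, S.inner ψ w = 0}

omit [IsTopologicalGroup G] in
/-- `S.inner` is additive in the first slot (continuous functions). -/
theorem inner_add_left_cont {φ φ' w : G → ℂ} (hφ : Continuous φ) (hφ' : Continuous φ') (hw : Continuous w) :
    S.inner (fun x => φ x + φ' x) w = S.inner φ w + S.inner φ' w := by
  have h := inner_eq_inner_toL2 S (hφ.add hφ') hw
  rw [toL2_add] at h
  rw [inner_eq_inner_toL2 S hφ hw, inner_eq_inner_toL2 S hφ' hw, ← inner_add_right]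
  exact h

omit [IsTopologicalGroup G] in
/-- `S.inner` is homogeneous in the first slot (continuous functions). -/
theorem inner_smul_left_cont {φ w : G → ℂ} (hφ : Continuous φ) (hw : Continuous w) (c : ℂ) :
    S.inner (fun x => c * φ x) w = c * S.inner φ w := by
  have hc : Continuous fun x => c * φ x := continuous_const.mul hφ
  have h := inner_eq_inner_toL2 S hc hw
  rw [show S.toL2 hc = c • S.toL2 hφ from toL2_smul S hφ c] at h
  rw [inner_eq_inner_toL2 S hφ hw, ← inner_smul_right]
  exact h

/-- **`orthSet F` is an invariant subspace** when every member of `F` is. -/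
theorem orthSet_isInvariantSubspace [SecondCountableTopology G] {F : Set (Set (G → ℂ))}
    (hF : ∀ V ∈ F, S.IsInvariantSubspace V) : S.IsInvariantSubspace (S.orthSet F) := by
  haveI : Countable S.Gk := S.countable_Gk
  refine ⟨fun ψ hψ => hψ.2.1, fun ψ hψ => hψ.1, ?_, ?_, ?_, ?_⟩
  · -- right translation
    rintro ψ ⟨hc, hinv, horth⟩ g
    refine ⟨hc.comp (continuous_id.mul continuous_const), fun γ x => ?_, ?_⟩
    · show ψ ((γ : G) * x * g) = ψ (x * g)
      rw [mul_assoc, hinv γ]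
    intro V hV w hw
    have hw' : (fun x => w (x * g⁻¹)) ∈ V := (hF V hV).right w hw g⁻¹
    have hwinv : S.Invariant w := (hF V hV).inv w hw
    have hw'inv : S.Invariant fun x => w (x * g⁻¹) := fun γ x => by
      show w ((γ : G) * x * g⁻¹) = w (x * g⁻¹)
      rw [mul_assoc, hwinv γ]
    have h1 := S.inner_rightTranslate hinv hw'inv g
    simp only [mul_inv_cancel_right] at h1
    rw [h1]
    exact horth V hV _ hw'
  · -- addition
    rintro ψ ⟨hc, hinv, horth⟩ ψ' ⟨hc', hinv', horth'⟩
    refine ⟨hc.add hc', fun γ x => ?_, fun V hV w hw => ?_⟩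
    · show ψ ((γ : G) * x) + ψ' ((γ : G) * x) = ψ x + ψ' x
      rw [hinv γ, hinv' γ]
    rw [inner_add_left_cont S hc hc' ((hF V hV).cont w hw), horth V hV w hw, horth' V hV w hw, add_zero]
  · -- scalars
    rintro ψ ⟨hc, hinv, horth⟩ c
    refine ⟨continuous_const.mul hc, fun γ x => ?_, fun V hV w hw => ?_⟩
    · show c * ψ ((γ : G) * x) = c * ψ x
      rw [hinv γ]
    rw [inner_smul_left_cont S hc ((hF V hV).cont w hw), horth V hV w hw, mul_zero]
  · -- `R(f)`
    rintro ψ ⟨hc, hinv, horth⟩ f hf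
    have hR : S.R f ψ = S.kernelOp f ψ := by
      funext x
      exact (S.kernelOp_eq_R hf hinv hc x).symm
    haveI := S.isFiniteMeasure_restrict_DG
    have hRc : Continuous (S.R f ψ) := by
      rw [hR]
      exact S.continuous_kernelOp hf ((S.memLp_restrict_of_continuous hc).integrable one_le_two)
    have hRinv : S.Invariant (S.R f ψ) := by
      rw [hR]
      exact S.kernelOp_invariant f ψ
    refine ⟨hRc, hRinv, fun V hV w hw => ?_⟩
    rw [S.inner_R_eq_inner_R_adj hf hinv hc ((hF V hV).inv w hw) ((hF V hV).cont w hw)]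
    exact horth V hV _ ((hF V hV).conv w hw _ hf.refl.cj)

omit [IsTopologicalGroup G] in
/-- Cauchy–Schwarz for `S.inner` on continuous functions: `‖S.inner φ w‖ ≤ ‖toL2 φ‖ · ‖toL2 w‖`. -/
theorem norm_inner_le' {φ w : G → ℂ} (hφ : Continuous φ) (hw : Continuous w) :
    ‖S.inner φ w‖ ≤ ‖S.toL2 hφ‖ * ‖S.toL2 hw‖ := by
  rw [inner_eq_inner_toL2 S hφ hw]
  calc ‖⟪S.toL2 hw, S.toL2 hφ⟫_ℂ‖ ≤ ‖S.toL2 hw‖ * ‖S.toL2 hφ‖ := norm_inner_le_norm _ _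
    _ = ‖S.toL2 hφ‖ * ‖S.toL2 hw‖ := mul_comm _ _

omit [IsTopologicalGroup G] in
/-- The `L²` norm of a continuous function is its `eLpNorm`. -/
theorem norm_toL2_eq {φ : G → ℂ} (hφ : Continuous φ) :
    ‖S.toL2 hφ‖ = (eLpNorm φ 2 (S.μ.restrict S.DG)).toReal := by
  unfold toL2
  rw [Lp.norm_toLp]

omit [IsTopologicalGroup G] in
/-- **`orthSet F` is relatively closed** (the `hclosed` shape of (4b)). -/
theorem orthSet_relClosed {F : Set (Set (G → ℂ))} (hF : ∀ V ∈ F, S.IsInvariantSubspace V) :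
    ∀ ψ : G → ℂ, Continuous ψ → S.Invariant ψ →
      (∀ ε : ℝ, 0 < ε → ∃ ψ' ∈ S.orthSet F,
        eLpNorm (fun x => ψ x - ψ' x) 2 (S.μ.restrict S.DG) < ENNReal.ofReal ε) → ψ ∈ S.orthSet F := by
  intro ψ hc hinv happ
  refine ⟨hc, hinv, fun V hV w hw => ?_⟩
  have hwc : Continuous w := (hF V hV).cont w hw
  -- `‖S.inner ψ w‖ ≤ ‖toL2 (ψ - ψ')‖ ‖toL2 w‖` for every approximant `ψ'`
  have key : ∀ ε : ℝ, 0 < ε → ‖S.inner ψ w‖ ≤ ε * ‖S.toL2 hwc‖ := by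
    intro ε hε
    obtain ⟨ψ', ⟨hc', _, horth'⟩, hlt⟩ := happ ε hε
    have hsub : Continuous fun x => ψ x - ψ' x := hc.sub hc'
    have h1 : S.inner ψ w = S.inner (fun x => ψ x - ψ' x) w := by
      have := inner_add_left_cont S hsub hc' hwc
      simp only [sub_add_cancel] at this
      rw [this, horth' V hV w hw, add_zero]
    have h2 : ‖S.toL2 hsub‖ ≤ ε := by
      rw [norm_toL2_eq]
      have hfin : eLpNorm (fun x => ψ x - ψ' x) 2 (S.μ.restrict S.DG) ≠ ⊤ := ne_top_of_lt hlt
      rw [← ENNReal.ofReal_toReal hfin] at hlt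
      exact le_of_lt ((ENNReal.ofReal_lt_ofReal_iff_of_nonneg ENNReal.toReal_nonneg).1 hlt)
    rw [h1]
    calc ‖S.inner (fun x => ψ x - ψ' x) w‖ ≤ ‖S.toL2 hsub‖ * ‖S.toL2 hwc‖ := norm_inner_le' S hsub hwc
      _ ≤ ε * ‖S.toL2 hwc‖ := by gcongr
  by_contra hne
  have hpos : 0 < ‖S.inner ψ w‖ := norm_pos_iff.2 hne
  by_cases hw0 : ‖S.toL2 hwc‖ = 0
  · have := key 1 one_pos
    rw [hw0, mul_zero] at this
    linarith
  · have hw0' : 0 < ‖S.toL2 hwc‖ := lt_of_le_of_ne (norm_nonneg _) (Ne.symm hw0)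
    have := key (‖S.inner ψ w‖ / (2 * ‖S.toL2 hwc‖)) (by positivity)
    have h3 : ‖S.inner ψ w‖ / (2 * ‖S.toL2 hwc‖) * ‖S.toL2 hwc‖ = ‖S.inner ψ w‖ / 2 := by
      field_simp
    rw [h3] at this
    linarith

omit [IsTopologicalGroup G] [BorelSpace G] in
/-- `K_f` of a.e.-equal functions coincide. -/
theorem kernelOp_congr_ae' (f : G → ℂ) {u v : G → ℂ} (h : u =ᵐ[S.μ.restrict S.DG] v) :
    S.kernelOp f u = S.kernelOp f v := by
  funext x
  unfold kernelOp
  exact integral_congr_ae (h.mono fun z hz => by dsimp only; rw [hz])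

/-- **`orthSet F` is non-zero** as soon as some `ψ₀ ∈ L²(DG)`, not a.e. zero, is orthogonal to every member of every
`V ∈ F`: rung (4a) exhibits a test `f` with `K_f ψ₀ ≠ 0` a.e., and `K_f ψ₀ ∈ orthSet F` by continuity, invariance and the
adjoint identity. -/
theorem exists_mem_orthSet_ne_zero [LocallyCompactSpace G] [SecondCountableTopology G] {F : Set (Set (G → ℂ))}
    (hF : ∀ V ∈ F, S.IsInvariantSubspace V) {ψ₀ : G → ℂ} (hψ₀ : MemLp ψ₀ 2 (S.μ.restrict S.DG))
    (hne : ¬ (ψ₀ =ᵐ[S.μ.restrict S.DG] 0)) (horth : ∀ V ∈ F, ∀ w ∈ V, S.inner ψ₀ w = 0) :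
    ∃ ψ ∈ S.orthSet F, ∃ x, ψ x ≠ 0 := by
  haveI := S.isFiniteMeasure_restrict_DG
  have hL : hψ₀.toLp ψ₀ ≠ 0 := by
    intro h
    apply hne
    rw [← MemLp.toLp_zero (MemLp.zero : MemLp (0 : G → ℂ) 2 (S.μ.restrict S.DG)),
      MemLp.toLp_eq_toLp_iff] at h
    exact h
  obtain ⟨f, hf, hK⟩ := S.kernelOp_nondegenerate (hψ₀.toLp ψ₀) hL
  rw [S.kernelOp_congr_ae' f hψ₀.coeFn_toLp] at hK
  refine ⟨S.kernelOp f ψ₀, ⟨S.continuous_kernelOp hf (hψ₀.integrable one_le_two), S.kernelOp_invariant f ψ₀,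
    fun V hV w hw => ?_⟩, ?_⟩
  · rw [S.inner_kernelOp_left hf hψ₀ (S.memLp_restrict_of_continuous ((hF V hV).cont w hw))]
    have hR : S.kernelOp (cj (refl f)) w = S.R (cj (refl f)) w :=
      funext fun x => S.kernelOp_eq_R hf.refl.cj ((hF V hV).inv w hw) ((hF V hV).cont w hw) x
    rw [hR]
    exact horth V hV _ ((hF V hV).conv w hw _ hf.refl.cj)
  · by_contra hall
    apply hK
    refine Filter.Eventually.of_forall fun x => ?_
    by_contra hx
    exact hall ⟨x, hx⟩

end Setting

end RTF

end Summit.Ventures.HodgeRepro.Tier4.Line1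

end
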